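import Mathlib
import HarnessLib
import Literature.AlgebraicGeometry.Resolution.ResolutionGlue
import Literature.AlgebraicGeometry.Resolution.ProjectiveSpaceRegular
import Summits.ResolutionOfSingularities.ResolutionOfSingularities.Theorems.WildQuotientsWildQuotientResolutionGluedQuotientPieces
import Summits.ResolutionOfSingularities.ResolutionOfSingularities.Theorems.WildQuotientsWildQuotientResolutionFixedPointsRegular
import Summits.ResolutionOfSingularities.ResolutionOfSingularities.Theorems.WildQuotientsWildQuotientResolutionFixedPointsGraded

/-!
# G3 — a quotient piece is regular from a presentation of its invariants; «K–L TWICE» on rings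

(crux stmt-ResolutionOfSingularities-15640 `WildQuotients.WildQuotientResolution`, line `Sketch`;
infrastructure for NON-CYCLIC finite groups (card O: O8 `𝔸⁴/ℤ4`, O9 `(V₂⊗V₂)/V₄`, …):
res-L1-w45c-plan-1 RULING 2026-08-27T16:02:41Z (2) «G3 `isRegular_pieceQuot_of_KL_twice` (ring-level
K–L twice ⇒ `IsRegular (pieceQuot O)`)»; design memo `L/w45c/O9-KLEINFOUR-DESIGN.md` §5 (G3).
[OURS · L1 W4.5c] — NOT a statement of any manuscript; replaces the role of no printed item.
Def-free. Prover res-L1-w45c-stub-3.)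

The V3U/V4U/V5/N4a frames show `Scheme.IsRegular (O/G)` for a `G`-stable affine piece `O` of a
model with `|G| = p` by Király–Lütkebohmert at the stalks (`ToricExit.isRegular_pieceQuot_of_stalkAug`).
For `|G| = p²` (and any finite `G` generated by two elements) the quotient piece
`O/G ≅ Spec Γ(O)^G` (`BlowupExit.exists_iso_spec_pieceQuot`, ANY finite `G`) is regular as soon as
`Γ(O)^G` is — and `Γ(O)^G = (Γ(O)^{g₁})^{ḡ₂}` is reached in TWO ring-level steps, no quotient SCHEME
by `g₁` being ever formed:

* `ActionOver.forall_act_eq_iff_of_closure_pair` — invariance under a generating pair suffices;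
* `BlowupExit.isRegular_pieceQuot_of_invariantsPresentation` — `O/G` is regular whenever SOME
  regular ring `R₀` maps injectively onto `Γ(O)^G` (any finite `G`; the V5 cone-brick pattern without
  a blow-up);
* **`BlowupExit.isRegular_pieceQuot_of_KL_twice`** — `G = ⟨g₁, g₂⟩`; `S₁` a regular domain of finite
  type over `k` presenting the `g₁`-invariants (`ψ₁ : S₁ ↪ Γ(O)`, range = `{x | g₁·x = x}` — in the
  applications `S₁` is EXPLICIT, e.g. B1 `fixedPoints_translate`); `τ` a `k`-automorphism of `S₁`
  of prime order intertwining `g₂` (`ψ₁ ∘ τ = g₂ ∘ ψ₁`) with principal augmentation ideal at every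
  `τ`-fixed prime (K–L, `TameTransfer.isRegularRing_fixedPoints_zpowers`): then `O/G` is regular.
-/

-- single-problem summit: the doubled namespace component `ResolutionOfSingularities` is forced
set_option linter.dupNamespace false

noncomputable section

open CategoryTheory AlgebraicGeometry TopologicalSpace
open Literature.AlgebraicGeometry.Resolution Literature.AlgebraicGeometry.RelativeSpec

namespace Literature.AlgebraicGeometry.RelativeSpec.ActionOver

/-- **Invariance under a generating pair is invariance under the group**: for an action `ρ` of
`G = ⟨g₁, g₂⟩` over a base and a section `x` over `r⁻¹U`, `(∀ g, g·x = x) ↔ g₁·x = x ∧ g₂·x = x`.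
[folklore] -/
theorem forall_act_eq_iff_of_closure_pair {X Y : Scheme} {r : X ⟶ Y} {G : Type*} [Group G]
    (ρ : ActionOver r G) (g₁ g₂ : G) (hgen : Subgroup.closure ({g₁, g₂} : Set G) = ⊤)
    (U : Y.Opens) (x : Γ(X, r ⁻¹ᵁ U)) :
    (∀ g : G, ρ.act g U x = x) ↔ ρ.act g₁ U x = x ∧ ρ.act g₂ U x = x := by
  refine ⟨fun h => ⟨h g₁, h g₂⟩, fun h g => ?_⟩
  have hg : g ∈ Subgroup.closure ({g₁, g₂} : Set G) := by rw [hgen]; exact Subgroup.mem_top g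
  induction hg using Subgroup.closure_induction with
  | mem y hy =>
    rcases hy with rfl | hy
    · exact h.1
    · rw [Set.mem_singleton_iff] at hy; subst hy; exact h.2
  | one => rw [ρ.act_one]; rfl
  | mul y z _ _ hy hz => rw [ρ.act_mul, RingHom.comp_apply, hz, hy]
  | inv y _ hy =>
    have e : ρ.act y⁻¹ U (ρ.act y U x) = x := by
      rw [← RingHom.comp_apply, ← ρ.act_mul, inv_mul_cancel, ρ.act_one]; rfl
    rwa [hy] at e

end Literature.AlgebraicGeometry.RelativeSpec.ActionOver

namespace Summit.ResolutionOfSingularities.ResolutionOfSingularities.Theorems.WildQuotientResolution.BlowupExit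

/-- **A quotient piece is regular from a regular presentation of its invariants** (any finite `G`):
for a `G`-stable open `O` affine over the affine base and an injective ring map `ψ : R₀ → Γ(O)` from a
REGULAR ring onto the invariants `Γ(O)^G`, the piece `O/G ≅ Spec Γ(O)^G ≅ Spec R₀` is a regular
scheme. [OURS · L1 W4.5c] [folklore; `exists_iso_spec_pieceQuot`] -/
theorem isRegular_pieceQuot_of_invariantsPresentation {X S : Scheme.{0}} {r : X ⟶ S} {G : Type}
    [Group G] [Finite G] (ρ : ActionOver r G) [IsSeparated r] [IsAffine S] (O : ρ.StableAffineOpens)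
    {R₀ : Type} [CommRing R₀] [IsRegularRing R₀]
    (ψ : R₀ →+* Γ((O.1 : Scheme.{0}), (O.1.ι ≫ r) ⁻¹ᵁ ⊤)) (hψ : Function.Injective ψ)
    (hrange : ψ.range = (ρ.restrict O.1 O.2.1).invariantsRing ⊤) :
    Scheme.IsRegular (ρ.pieceQuot O) := by
  obtain ⟨e, -⟩ := exists_iso_spec_pieceQuot ρ O
  have hmem : ∀ z, ψ z ∈ (ρ.restrict O.1 O.2.1).invariantsRing ⊤ := fun z => by
    rw [← hrange]; exact ⟨z, rfl⟩
  have hbij : Function.Bijective (ψ.codRestrict ((ρ.restrict O.1 O.2.1).invariantsRing ⊤) hmem) := by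
    refine ⟨fun a b hab => hψ (congrArg Subtype.val hab), fun y => ?_⟩
    have hy : (y : Γ((O.1 : Scheme.{0}), (O.1.ι ≫ r) ⁻¹ᵁ ⊤)) ∈ ψ.range := by
      rw [hrange]; exact y.2
    obtain ⟨z, hz⟩ := hy
    exact ⟨z, Subtype.ext hz⟩
  haveI : IsRegularRing ((ρ.restrict O.1 O.2.1).invariantsRing ⊤) :=
    IsRegularRing.of_ringEquiv (RingEquiv.ofBijective _ hbij)
  exact Scheme.IsRegular.of_iso e.hom (Scheme.isRegular_Spec _)

/-- **G3 — «K–L twice»: the quotient piece by `G = ⟨g₁, g₂⟩` is regular.** Let `O` be a `G`-stable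
open affine over the affine base, `S₁` a regular domain of finite type over a field `k` with an
injective `ψ₁ : S₁ → Γ(O)` onto the `g₁`-invariant sections, and `τ` a `k`-automorphism of `S₁` of
prime order `p` through which `g₂` acts (`ψ₁ (τ s) = g₂ · ψ₁ s`). If the augmentation ideal of `τ`
is principal at every `τ`-fixed prime of `S₁` (Király–Lütkebohmert), then `O/G` is a regular scheme:
`Γ(O)^G = ψ₁(S₁^{⟨τ⟩})` and `S₁^{⟨τ⟩}` is regular. No quotient scheme by `g₁` alone is formed; in the
applications (O8/O9) `S₁` is the explicit B1 presentation of the `g₁`-invariants.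
[OURS · L1 W4.5c] [cite: KiralyLutkebohmert2013, Thm 2] -/
theorem isRegular_pieceQuot_of_KL_twice {X S : Scheme.{0}} {r : X ⟶ S} {G : Type} [Group G]
    [Finite G] (ρ : ActionOver r G) [IsSeparated r] [IsAffine S] (O : ρ.StableAffineOpens)
    (g₁ g₂ : G) (hgen : Subgroup.closure ({g₁, g₂} : Set G) = ⊤)
    {k : Type} [Field k] {S₁ : Type} [CommRing S₁] [IsDomain S₁] [IsRegularRing S₁] [Algebra k S₁]
    [Algebra.FiniteType k S₁]
    (ψ₁ : S₁ →+* Γ((O.1 : Scheme.{0}), (O.1.ι ≫ r) ⁻¹ᵁ ⊤)) (hψ₁ : Function.Injective ψ₁)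
    (hrange₁ : ∀ x, x ∈ Set.range ψ₁ ↔ (ρ.restrict O.1 O.2.1).act g₁ ⊤ x = x)
    {p : ℕ} (hp : p.Prime) (τ : S₁ ≃ₐ[k] S₁) (hτp : τ ^ p = 1)
    (hinter : ∀ s, ψ₁ (τ s) = (ρ.restrict O.1 O.2.1).act g₂ ⊤ (ψ₁ s))
    (hdiv : ∀ (𝔮 : Ideal S₁) [𝔮.IsPrime], 𝔮.comap τ = 𝔮 →
      ((Ideal.span (Set.range fun u : S₁ => τ u - u)).map
        (algebraMap S₁ (Localization.AtPrime 𝔮))).IsPrincipal) :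
    Scheme.IsRegular (ρ.pieceQuot O) := by
  classical
  -- `S₁^{⟨τ⟩}` is regular (K–L, or trivially if `τ = 1`)
  have hreg : IsRegularRing (FixedPoints.subalgebra k S₁ (Subgroup.zpowers τ)) := by
    by_cases hτ1 : τ = 1
    · subst hτ1
      have htop : FixedPoints.subalgebra k S₁ (Subgroup.zpowers (1 : S₁ ≃ₐ[k] S₁)) = ⊤ := by
        rw [eq_top_iff]
        intro s _
        rw [TameTransfer.mem_fixedPoints_zpowers_iff_apply_eq, AlgEquiv.one_apply]
      rw [htop]
      exact IsRegularRing.of_ringEquiv (Subalgebra.topEquiv (R := k) (A := S₁)).symm.toRingEquiv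
    · exact TameTransfer.isRegularRing_fixedPoints_zpowers hp τ hτ1 hτp hdiv
  -- `ψ := ψ₁ ∘ (S₁^{⟨τ⟩} ⊆ S₁)` presents the `G`-invariants
  let ψ : FixedPoints.subalgebra k S₁ (Subgroup.zpowers τ) →+*
      Γ((O.1 : Scheme.{0}), (O.1.ι ≫ r) ⁻¹ᵁ ⊤) :=
    ψ₁.comp (FixedPoints.subalgebra k S₁ (Subgroup.zpowers τ)).val.toRingHom
  have hψapp : ∀ s, ψ s = ψ₁ (s : S₁) := fun _ => rfl
  have hψinj : Function.Injective ψ := hψ₁.comp Subtype.val_injective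
  haveI := hreg
  refine isRegular_pieceQuot_of_invariantsPresentation ρ O ψ hψinj ?_
  ext x
  rw [RingHom.mem_range, ActionOver.mem_invariantsRing_iff,
    ActionOver.forall_act_eq_iff_of_closure_pair _ g₁ g₂ hgen]
  constructor
  · rintro ⟨s, rfl⟩
    refine ⟨(hrange₁ _).mp ⟨(s : S₁), (hψapp s).symm⟩, ?_⟩
    rw [hψapp, ← hinter, (TameTransfer.mem_fixedPoints_zpowers_iff_apply_eq τ (s : S₁)).mp s.2]
  · rintro ⟨h1, h2⟩
    obtain ⟨s, hs⟩ := (hrange₁ x).mpr h1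
    have hτs : τ s = s := by
      apply hψ₁
      rw [hinter, hs, h2]
    exact ⟨⟨s, (TameTransfer.mem_fixedPoints_zpowers_iff_apply_eq τ s).mpr hτs⟩, hs⟩

end Summit.ResolutionOfSingularities.ResolutionOfSingularities.Theorems.WildQuotientResolution.BlowupExit

end
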